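import Literature.Geometry.Lorentzian.SchwarzschildKerrSchildComponents
import HarnessLib

/-!
# `KerrShieldedDataExist` — the chart-R → chart-L transition of the harvest is an isometry of the
# Schwarzschild Kerr–Schild form, orientation-compatible exactly inside the horizon

Negative-side / support lemma for crux `stmt-FinalStateConjecture-10055` (route SwallowTheDatum; standing
disprover, gen 4; work file `Cruxes/KerrShieldedDataExist/Disproof.lean` §12.1). The picked line
`plug-the-second-sheet` assembles its witness from TWO ingoing Kerr–Schild charts of the same Kruskal(M)
spacetime: chart R (regions I ∪ II, the tree's `Kerr.smoothMetric M 0 r₀`) and the reflected chart L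
(regions II ∪ III), related on region II by `Θ(t*, x⃗) = (−t* + 4M log(1 − r/2M), x⃗)` (same `x⃗`). This file
proves, at the level of the tree's 4-dimensional form `Kerr.bilin M 0` and time vector `Kerr.timeVector M 0`:

* `kruskalFlip M x` — the differential `Θ_* v = (−v⁰ + 4M⟪x⃗, v⃗⟫/(r(r − 2M)), v⃗)` — is an involution
  (`kruskalFlip_kruskalFlip`) and an ISOMETRY of `g_{M,0}(x)` onto itself for `r ∉ {0, 2M}`
  (`bilin_kruskalFlip`; 2-form version: `dv_L = −dv_R + (2/f) dr` preserves `−f dv² + 2 dv dr`), so chart L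
  carries the SAME `Kerr.smoothMetric M 0 r₀` formulas;
* `g(V, Θ_* V) = (r² + 4M²)/(r(r − 2M))` for `V = Kerr.timeVector M 0 x` (`bilin_timeVector_kruskalFlip`), hence
  `< 0` on `0 < r < 2M` (`bilin_timeVector_kruskalFlip_neg`: the two charts' time orientations AGREE on region
  II, so future unit normals and second fundamental forms computed chart-wise glue) and `> 0` on `r > 2M`
  (`bilin_timeVector_kruskalFlip_pos`: used outside the horizon the same formula REVERSES the orientation —
  there it is the white-hole chart of region I / the map onto region III; the harvest's overlap must stay in
  `r < 2M`).

What is left to the harvest is `HasFDerivAt Θ (kruskalFlip M x) x` (`Real.log ∘ (1 − ‖E4.spatial ·‖/2M)`) and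
the `mfderiv` bookkeeping. O'Neill, *Semi-Riemannian geometry* (1983), Ch. 13 (Kruskal plane); Dafermos–Rodnianski
arXiv:0811.0354, §5.1 (the ingoing chart and `V = −g♯dt*`).
-/

set_option linter.dupNamespace false

noncomputable section

open scoped InnerProductSpace
open Literature.Geometry.Lorentzian

namespace Summit.FinalStateConjecture.FinalStateConjecture.Theorems.KerrShieldedDataExist.Negative

section KruskalFlip

variable (M : ℝ)

/-- The differential of the Kruskal reflection / chart transition `Θ(t*, x⃗) = (−t* + 4M log|1 − r/2M|, x⃗)` at `x`:
`v ↦ (−v⁰ + 4M⟪x⃗, v⃗⟫/(r(r − 2M)), v⃗)`, `r = ‖x⃗‖`. [cite: ONeill1983, Ch. 13] -/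
def kruskalFlip (x v : E4) : E4 :=
  E4.ofTimeSpace (-(v 0) + 4 * M / (E4.spatialNorm x * (E4.spatialNorm x - 2 * M)) *
    ⟪E4.spatial x, E4.spatial v⟫_ℝ) (E4.spatial v)

/-- Time component of `Θ_* v`. [cite: ONeill1983, Ch. 13] -/
@[simp] theorem kruskalFlip_apply_zero (x v : E4) :
    kruskalFlip M x v 0 = -(v 0) + 4 * M / (E4.spatialNorm x * (E4.spatialNorm x - 2 * M)) *
      ⟪E4.spatial x, E4.spatial v⟫_ℝ := by
  simp [kruskalFlip]

/-- `Θ_*` does not move the spatial part. [cite: ONeill1983, Ch. 13] -/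
@[simp] theorem spatial_kruskalFlip (x v : E4) : E4.spatial (kruskalFlip M x v) = E4.spatial v := by
  simp [kruskalFlip]

/-- `Θ_*` is an involution. [cite: ONeill1983, Ch. 13] -/
theorem kruskalFlip_kruskalFlip (x v : E4) : kruskalFlip M x (kruskalFlip M x v) = v := by
  have h0 : kruskalFlip M x (kruskalFlip M x v) 0 = v 0 := by simp
  have hs : E4.spatial (kruskalFlip M x (kruskalFlip M x v)) = E4.spatial v := by simp
  calc kruskalFlip M x (kruskalFlip M x v)
      = E4.ofTimeSpace (E4.time (kruskalFlip M x (kruskalFlip M x v)))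
          (E4.spatial (kruskalFlip M x (kruskalFlip M x v))) := (E4.ofTimeSpace_time_spatial _).symm
    _ = E4.ofTimeSpace (E4.time v) (E4.spatial v) := by rw [E4.time_apply, h0, hs, ← E4.time_apply]
    _ = v := E4.ofTimeSpace_time_spatial v

/-- **The chart transition is an isometry of the Schwarzschild Kerr–Schild form onto itself**:
`g_{M,0}(x)(Θ_* v, Θ_* w) = g_{M,0}(x)(v, w)` at every `x` with `r ≠ 0`, `r ≠ 2M`. [cite: ONeill1983, Ch. 13] -/
theorem bilin_kruskalFlip {x : E4} (hx : E4.spatialNorm x ≠ 0) (hx2 : E4.spatialNorm x ≠ 2 * M) (v w : E4) :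
    Kerr.bilin M 0 x (kruskalFlip M x v) (kruskalFlip M x w) = Kerr.bilin M 0 x v w := by
  have h2 : E4.spatialNorm x - 2 * M ≠ 0 := sub_ne_zero.2 hx2
  have h2' : E4.spatialNorm x - M * 2 ≠ 0 := by rwa [mul_comm] at h2
  rw [Kerr.bilin_zero_spin_apply M hx, Kerr.bilin_zero_spin_apply M hx]
  simp only [kruskalFlip_apply_zero, spatial_kruskalFlip]
  field_simp
  ring

/-- `V⁰ = 1 + 2H` for `V = Kerr.timeVector M 0 x` (`ℓ₀ = 1`). [cite: arXiv08110354, §5.1] -/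
theorem timeVector_zero_spin_apply_zero (x : E4) : Kerr.timeVector M 0 x 0 = 1 + 2 * Kerr.scalarH M 0 x := by
  simp [Kerr.timeVector, Kerr.nullVector, Kerr.nullCovectorFun]

/-- `⟪x⃗, V⃗⟫ = −2H r` for `V = Kerr.timeVector M 0 x = (1 + 2H, −2H x⃗/r)`. [cite: arXiv08110354, §5.1] -/
theorem inner_spatial_timeVector_zero_spin {x : E4} (hx : E4.spatialNorm x ≠ 0) :
    ⟪E4.spatial x, E4.spatial (Kerr.timeVector M 0 x)⟫_ℝ = -(2 * Kerr.scalarH M 0 x) * E4.spatialNorm x := by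
  rw [Kerr.inner_spatial_eq]
  have hsq := E4.spatialNorm_sq x
  simp only [Kerr.timeVector, Kerr.nullVector, Kerr.nullCovectorFun, Kerr.radius_zero_left]
  simp
  field_simp
  rw [hsq]
  ring

/-- **Time orientation under the transition**: `g(V, Θ_* V) = (r² + 4M²)/(r(r − 2M))` for `V = Kerr.timeVector M 0 x`
(`r ∉ {0, 2M}`). [cite: ONeill1983, Ch. 13] -/
theorem bilin_timeVector_kruskalFlip {x : E4} (hx : E4.spatialNorm x ≠ 0) (hx2 : E4.spatialNorm x ≠ 2 * M) :
    Kerr.bilin M 0 x (Kerr.timeVector M 0 x) (kruskalFlip M x (Kerr.timeVector M 0 x)) =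
      (E4.spatialNorm x ^ 2 + 4 * M ^ 2) / (E4.spatialNorm x * (E4.spatialNorm x - 2 * M)) := by
  have h2 : E4.spatialNorm x - 2 * M ≠ 0 := sub_ne_zero.2 hx2
  have h2' : E4.spatialNorm x - M * 2 ≠ 0 := by rwa [mul_comm] at h2
  have hr : 0 < Kerr.radius 0 x := by
    rw [Kerr.radius_zero_left]; exact lt_of_le_of_ne (E4.spatialNorm_nonneg x) (Ne.symm hx)
  rw [Kerr.bilin_timeVector hr, kruskalFlip_apply_zero, timeVector_zero_spin_apply_zero,
    inner_spatial_timeVector_zero_spin M hx, Kerr.scalarH_zero_spin M hx]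
  field_simp
  ring

/-- **Inside the horizon the two ingoing charts are time-orientation compatible**: on `0 < r < 2M`,
`g(V, Θ_* V) < 0`. [cite: ONeill1983, Ch. 13] -/
theorem bilin_timeVector_kruskalFlip_neg {x : E4} (h0 : 0 < E4.spatialNorm x) (h2 : E4.spatialNorm x < 2 * M) :
    Kerr.bilin M 0 x (Kerr.timeVector M 0 x) (kruskalFlip M x (Kerr.timeVector M 0 x)) < 0 := by
  rw [bilin_timeVector_kruskalFlip M h0.ne' h2.ne]
  apply div_neg_of_pos_of_neg
  · positivity
  · nlinarith

/-- **Outside the horizon the same formula reverses the time orientation**: on `r > 2M ≥ 0`, `g(V, Θ_* V) > 0`.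
[cite: ONeill1983, Ch. 13] -/
theorem bilin_timeVector_kruskalFlip_pos (hM : 0 ≤ M) {x : E4} (h2 : 2 * M < E4.spatialNorm x) :
    0 < Kerr.bilin M 0 x (Kerr.timeVector M 0 x) (kruskalFlip M x (Kerr.timeVector M 0 x)) := by
  have h0 : 0 < E4.spatialNorm x := by linarith
  rw [bilin_timeVector_kruskalFlip M h0.ne' h2.ne']
  apply div_pos
  · positivity
  · nlinarith

end KruskalFlip

end Summit.FinalStateConjecture.FinalStateConjecture.Theorems.KerrShieldedDataExist.Negative

end
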